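import Mathlib
import Literature.MathematicalPhysics.StatisticalMechanics.BarlowStacking

/-!
# `GappedShellCensus.CleanLimitsHaveWindows` (stmt-AtomisticToContinuum-15932), line `Sketch`:
# laminar pinning (stub `stub_laminarPinning`, L3), part 1 — the horizontal frame of an isotropic pair

Assembly step (S5) of the laminar pinning: once the planar lattice `ℤu + ℤv` of a laminar set is known to be
isotropic (`‖u‖ = ‖v‖ = ‖u - v‖ = a'`), there is a linear isometry `R` of `ℝ³` fixing the normal `e₃` with
`R (triangularVec₁ a') = u`, `R (triangularVec₂ a') = v`, hence `R (barlowOffset a') = (u + v)/3`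
(`lp_exists_frame`); it is the isometry of the orthonormal frame `u/a'`, `(2v - u)/(a'√3)`, `e₃`. With it, a laminar
set with isotropic lattice and hollow registry of consecutive layers is rewritten in the exactly layered normal form
`v + A' (S(a', s, z))` of `CleanHull.boxPinning` (`lp_exact_of_symmetric`: Hägg bookkeeping `lp_offsets_hagg` of the
offsets, `A' = A ∘ R`, `v = v₀ + A (w 0)`).
-/

noncomputable section

namespace Summit.AtomisticToContinuum.Crystallization.Theorems.CleanHull

open Literature.MathematicalPhysics.StatisticalMechanics

/-- The inner products of an isotropic horizontal pair with itself and with `e₃`. [folklore] -/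
theorem lp_inner_data {a' : ℝ} {u v : EuclideanSpace ℝ (Fin 3)} (hu2 : u 2 = 0) (hv2 : v 2 = 0)
    (hu : ‖u‖ = a') (hv : ‖v‖ = a') (huv : ‖u - v‖ = a') :
    inner ℝ u u = a' ^ 2 ∧ inner ℝ v v = a' ^ 2 ∧ inner ℝ u v = a' ^ 2 / 2 ∧
      inner ℝ u (layerNormal 1) = (0 : ℝ) ∧ inner ℝ v (layerNormal 1) = (0 : ℝ) ∧
      inner ℝ (layerNormal (1 : ℝ)) (layerNormal 1) = (1 : ℝ) := by
  have huu : inner ℝ u u = a' ^ 2 := by rw [real_inner_self_eq_norm_sq, hu]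
  have hvv : inner ℝ v v = a' ^ 2 := by rw [real_inner_self_eq_norm_sq, hv]
  refine ⟨huu, hvv, ?_, ?_, ?_, ?_⟩
  · have h := @norm_sub_sq_real _ _ _ u v
    rw [huv, hu, hv] at h
    linarith
  · simp [EuclideanSpace.inner_eq_star_dotProduct, dotProduct, Fin.sum_univ_three, layerNormal, hu2]
  · simp [EuclideanSpace.inner_eq_star_dotProduct, dotProduct, Fin.sum_univ_three, layerNormal, hv2]
  · rw [EuclideanSpace.inner_eq_star_dotProduct]
    simp [dotProduct, Fin.sum_univ_three, layerNormal]

/-- The horizontal frame `u/a'`, `(2v - u)/(a'√3)`, `e₃` of an isotropic horizontal pair is orthonormal. [folklore] -/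
theorem lpFrame_orthonormal {a' : ℝ} {u v : EuclideanSpace ℝ (Fin 3)} (ha' : 0 < a') (hu2 : u 2 = 0)
    (hv2 : v 2 = 0) (hu : ‖u‖ = a') (hv : ‖v‖ = a') (huv : ‖u - v‖ = a') :
    Orthonormal ℝ ![a'⁻¹ • u, (a' * Real.sqrt 3)⁻¹ • ((2 : ℝ) • v - u), layerNormal 1] := by
  classical
  obtain ⟨huu, hvv, huv', hue, hve, hee⟩ := lp_inner_data hu2 hv2 hu hv huv
  have h3 : Real.sqrt 3 ^ 2 = 3 := Real.sq_sqrt (by norm_num)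
  have ha0 : a' ≠ 0 := ha'.ne'
  have hvu : inner ℝ v u = a' ^ 2 / 2 := by rw [real_inner_comm]; exact huv'
  have heu : inner ℝ (layerNormal (1 : ℝ)) u = (0 : ℝ) := by rw [real_inner_comm]; exact hue
  have hev : inner ℝ (layerNormal (1 : ℝ)) v = (0 : ℝ) := by rw [real_inner_comm]; exact hve
  rw [orthonormal_iff_ite]
  intro i j
  fin_cases i <;> fin_cases j <;>
    simp only [Fin.zero_eta, Fin.mk_one, Fin.reduceFinMk, Matrix.cons_val_zero, Matrix.cons_val_one,
      Matrix.cons_val, real_inner_smul_left, real_inner_smul_right, inner_sub_left, inner_sub_right,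
      huu, hvv, huv', hvu, hue, hve, heu, hev, hee, Fin.isValue] <;> norm_num <;>
    first | decide | (right; ring) | (field_simp; done) | (field_simp; ring_nf; done) | (field_simp; rw [h3]; ring)

/-- **The frame isometry.** For an isotropic horizontal pair `u, v` there is a linear isometry `R` of `ℝ³` with
`R u(a') = u`, `R v(a') = v`, `R w(a') = (u + v)/3`, `R e₃ = e₃`. [folklore] -/
theorem lp_exists_frame {a' : ℝ} {u v : EuclideanSpace ℝ (Fin 3)} (ha' : 0 < a') (hu2 : u 2 = 0) (hv2 : v 2 = 0)
    (hu : ‖u‖ = a') (hv : ‖v‖ = a') (huv : ‖u - v‖ = a') :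
    ∃ R : EuclideanSpace ℝ (Fin 3) →ₗᵢ[ℝ] EuclideanSpace ℝ (Fin 3),
      R (triangularVec₁ a') = u ∧ R (triangularVec₂ a') = v ∧ R (barlowOffset a') = (1 / 3 : ℝ) • (u + v) ∧
        R (layerNormal 1) = layerNormal 1 := by
  have hon := lpFrame_orthonormal ha' hu2 hv2 hu hv huv
  have hsp : ⊤ ≤ Submodule.span ℝ
      (Set.range ![a'⁻¹ • u, (a' * Real.sqrt 3)⁻¹ • ((2 : ℝ) • v - u), layerNormal 1]) :=
    (hon.linearIndependent.span_eq_top_of_card_eq_finrank' (by simp)).ge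
  set b := OrthonormalBasis.mk hon hsp with hb_def
  have hb : ∀ i, b i = ![a'⁻¹ • u, (a' * Real.sqrt 3)⁻¹ • ((2 : ℝ) • v - u), layerNormal 1] i := fun i => by
    rw [hb_def, OrthonormalBasis.coe_mk]
  have ha0 : a' ≠ 0 := ha'.ne'
  have hs3 : Real.sqrt 3 ≠ 0 := (Real.sqrt_pos.2 (by norm_num : (0 : ℝ) < 3)).ne'
  have key : ∀ x : EuclideanSpace ℝ (Fin 3), b.repr.symm x =
      x 0 • (a'⁻¹ • u) + x 1 • ((a' * Real.sqrt 3)⁻¹ • ((2 : ℝ) • v - u)) + x 2 • layerNormal 1 := by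
    intro x
    rw [← b.sum_repr_symm, Fin.sum_univ_three, hb, hb, hb]
    rfl
  refine ⟨b.repr.symm.toLinearIsometry, ?_, ?_, ?_, ?_⟩ <;>
    (show b.repr.symm _ = _) <;> rw [key]
  · have e1 : a' * a'⁻¹ = 1 := by field_simp
    simp [triangularVec₁, smul_smul, e1]
  · have e1 : a' / 2 * a'⁻¹ = 1 / 2 := by field_simp
    have e2 : a' * Real.sqrt 3 / 2 * (a' * Real.sqrt 3)⁻¹ = 1 / 2 := by field_simp
    simp only [triangularVec₂, PiLp.toLp_apply, Matrix.cons_val_zero, Matrix.cons_val_one, Matrix.cons_val,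
      smul_smul, e1, e2, zero_smul, add_zero]
    module
  · have e1 : a' / 2 * a'⁻¹ = 1 / 2 := by field_simp
    have e2 : a' * Real.sqrt 3 / 6 * (a' * Real.sqrt 3)⁻¹ = 1 / 6 := by field_simp
    simp only [barlowOffset, PiLp.toLp_apply, Matrix.cons_val_zero, Matrix.cons_val_one, Matrix.cons_val,
      smul_smul, e1, e2, zero_smul, add_zero]
    module
  · simp [layerNormal]

/-- **Hägg bookkeeping of the offsets.** If consecutive offsets differ by a lattice vector plus `(s m / 3)(u + v)`,
then `w m = w 0 + (lattice vector) + (haggLabel s m / 3)(u + v)` for every `m : ℤ`. [folklore] -/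
theorem lp_offsets_hagg {u v : EuclideanSpace ℝ (Fin 3)} {w : ℤ → EuclideanSpace ℝ (Fin 3)} (s : ℤ → ℤ)
    (hstep : ∀ m : ℤ, ∃ i j : ℤ, w (m + 1) - w m = (i : ℝ) • u + (j : ℝ) • v + ((s m : ℝ) / 3) • (u + v)) :
    ∀ m : ℤ, ∃ I J : ℤ, w m = w 0 + (I : ℝ) • u + (J : ℝ) • v + ((haggLabel s m : ℝ) / 3) • (u + v) := by
  intro m
  induction m using Int.induction_on with
  | zero => exact ⟨0, 0, by simp⟩
  | succ n ih =>
    obtain ⟨I, J, hIJ⟩ := ih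
    obtain ⟨i, j, hij⟩ := hstep n
    refine ⟨I + i, J + j, ?_⟩
    rw [haggLabel_succ, show w ((n : ℤ) + 1) = w n + (w ((n : ℤ) + 1) - w n) by abel, hij, hIJ]
    push_cast
    module
  | pred n ih =>
    obtain ⟨I, J, hIJ⟩ := ih
    obtain ⟨i, j, hij⟩ := hstep (-(n : ℤ) - 1)
    have hl := haggLabel_succ s (-(n : ℤ) - 1)
    rw [show -(n : ℤ) - 1 + 1 = -n by ring] at hij hl
    refine ⟨I - i, J - j, ?_⟩
    have hl' : (haggLabel s (-(n : ℤ) - 1) : ℝ) = haggLabel s (-n) - s (-(n : ℤ) - 1) := by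
      rw [hl]; push_cast; ring
    rw [show w (-(n : ℤ) - 1) = w (-n) - (w (-(n : ℤ)) - w (-(n : ℤ) - 1)) by abel, hij, hIJ, hl']
    push_cast
    module

/-- **The exactly layered normal form of a symmetric laminar set (assembly step S5 of the laminar pinning).**
A laminar set `Z = v₀ + A {i u + j v + w m + z m e₃}` whose planar lattice is isotropic (`‖u‖ = ‖v‖ = ‖u - v‖ = a'`)
and whose consecutive offsets are in hollow registry (`w (m+1) - w m ∈ ℤu + ℤv ± (u + v)/3`) is exactly
layered: `Z = v + A' (S(a', s, z))` for a Hägg word `s`, the same heights, `A' = A ∘ R` (`R` the frame isometry)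
and `v = v₀ + A (w 0)`. [folklore] -/
theorem lp_exact_of_symmetric (Z : Set (EuclideanSpace ℝ (Fin 3)))
    (A : EuclideanSpace ℝ (Fin 3) →ₗᵢ[ℝ] EuclideanSpace ℝ (Fin 3)) (u v : EuclideanSpace ℝ (Fin 3))
    (w : ℤ → EuclideanSpace ℝ (Fin 3)) (z : ℤ → ℝ) (v₀ : EuclideanSpace ℝ (Fin 3)) (a' : ℝ) (ha' : 0 < a')
    (hu2 : u 2 = 0) (hv2 : v 2 = 0) (hu : ‖u‖ = a') (hv : ‖v‖ = a') (huv : ‖u - v‖ = a')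
    (hz : ∀ m : ℤ, z m < z (m + 1))
    (hZ : Z = (fun p => p + v₀) '' {p : EuclideanSpace ℝ (Fin 3) | ∃ m i j : ℤ,
        p = A (((i : ℝ) • u) + ((j : ℝ) • v) + w m + (z m • layerNormal 1))})
    (hholl : ∀ m : ℤ, ∃ i j ε : ℤ, (ε = 1 ∨ ε = -1) ∧
      w (m + 1) - w m = (i : ℝ) • u + (j : ℝ) • v + ((ε : ℝ) / 3) • (u + v)) :
    ∃ (a'' : ℝ) (A' : EuclideanSpace ℝ (Fin 3) →ₗᵢ[ℝ] EuclideanSpace ℝ (Fin 3)) (s : ℤ → ℤ) (z' : ℤ → ℝ)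
      (v' : EuclideanSpace ℝ (Fin 3)), 0 < a'' ∧ IsHaggSeq s ∧ (∀ m : ℤ, 0 < z' (m + 1) - z' m) ∧
      Z = (fun p => p + v') '' {p | ∃ m i j : ℤ, p = A' (((i : ℝ) • triangularVec₁ a'') +
        ((j : ℝ) • triangularVec₂ a'') + ((haggLabel s m : ℝ) • barlowOffset a'') + (z' m • layerNormal 1))} := by
  choose fi fj ε hε hstep using hholl
  obtain ⟨R, hR1, hR2, hR3, hR4⟩ := lp_exists_frame ha' hu2 hv2 hu hv huv
  have hlab := lp_offsets_hagg (u := u) (v := v) (w := w) ε fun m => ⟨fi m, fj m, hstep m⟩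
  refine ⟨a', A.comp R, ε, z, v₀ + A (w 0), ha', hε, fun m => sub_pos.2 (hz m), ?_⟩
  -- the images of the code points under `R`
  have hRpt : ∀ (i j L : ℤ) (t : ℝ), R (((i : ℝ) • triangularVec₁ a') + ((j : ℝ) • triangularVec₂ a') +
      ((L : ℝ) • barlowOffset a') + (t • layerNormal 1)) =
      (i : ℝ) • u + (j : ℝ) • v + ((L : ℝ) / 3) • (u + v) + t • layerNormal 1 := by
    intro i j L t
    simp only [map_add, map_smul, hR1, hR2, hR3, hR4, smul_smul]
    congr 2
    ring_nf
  rw [hZ]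
  ext p
  simp only [Set.mem_image, Set.mem_setOf_eq, LinearIsometry.coe_comp, Function.comp_apply]
  constructor
  · rintro ⟨q, ⟨m, i, j, rfl⟩, rfl⟩
    obtain ⟨I, J, hIJ⟩ := hlab m
    refine ⟨A (R (((i + I : ℤ) : ℝ) • triangularVec₁ a' + ((j + J : ℤ) : ℝ) • triangularVec₂ a' +
      ((haggLabel ε m : ℝ) • barlowOffset a') + (z m • layerNormal 1))), ⟨m, i + I, j + J, rfl⟩, ?_⟩
    rw [hRpt, hIJ]
    have e : (((i + I : ℤ) : ℝ) • u + ((j + J : ℤ) : ℝ) • v + ((haggLabel ε m : ℝ) / 3) • (u + v) +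
        z m • layerNormal 1) = ((i : ℝ) • u + (j : ℝ) • v +
          (w 0 + (I : ℝ) • u + (J : ℝ) • v + ((haggLabel ε m : ℝ) / 3) • (u + v)) + z m • layerNormal 1) - w 0 := by
      push_cast; module
    rw [e, map_sub]
    abel
  · rintro ⟨q, ⟨m, i, j, rfl⟩, rfl⟩
    obtain ⟨I, J, hIJ⟩ := hlab m
    refine ⟨A ((((i - I : ℤ) : ℝ) • u) + (((j - J : ℤ) : ℝ) • v) + w m + (z m • layerNormal 1)),
      ⟨m, i - I, j - J, rfl⟩, ?_⟩
    rw [hRpt, hIJ]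
    have e : (((i - I : ℤ) : ℝ) • u + ((j - J : ℤ) : ℝ) • v +
        (w 0 + (I : ℝ) • u + (J : ℝ) • v + ((haggLabel ε m : ℝ) / 3) • (u + v)) + z m • layerNormal 1) =
        ((i : ℝ) • u + (j : ℝ) • v + ((haggLabel ε m : ℝ) / 3) • (u + v) + z m • layerNormal 1) + w 0 := by
      push_cast; module
    rw [e, map_add]
    abel

end Summit.AtomisticToContinuum.Crystallization.Theorems.CleanHull

end
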